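import Mathlib
import Summits.ValiantsHypothesis.ValiantsHypothesis.Theorems.LacunarySymmetroidMatrixDescartesCensusDefs
import Summits.ValiantsHypothesis.ValiantsHypothesis.Theorems.LacunarySymmetroidMatrixDescartesCensusRealExponentsDoors
import Summits.ValiantsHypothesis.ValiantsHypothesis.Theorems.LacunarySymmetroidMatrixDescartesCensusRealExponentsLocus

/-!
# Wall bubbling for `DoorA26` — CONE TRANSFER: a landed chamber row empties the whole REAL open cone of twenties, hence the census retires walls

LINE / STUBS.  Crux `Theses.LacunarySymmetroid.DoorA26` (stmt-ValiantsHypothesis-19979; OPEN, typed, never asserted), line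
`Cruxes/DoorA26/Lines/wall_bubbling.lean` (obligations (M) `stub_mixedWalls`, (D), (W)).  The line works over REAL exponents `δ ∈ ℝ⁶` (twenty-locus
`T`, `isOpen_twentyLocus_two_six`), the census line over INTEGER supports `d` in the 2 608 chambers (`Census.doorA26_on_chamber<n> : StrictMono (pairSum d ∘ σₙ) →
PosRootLawOn 2 6 19 d`).  This file is the DICTIONARY (def-free; a rung serving (M)/(D), nothing about them or `DoorA26` itself):
* `realCone_row_of_natRow` — **CONE TRANSFER**: if the door-A row holds for every INTEGER support whose pair sums are strictly ordered along an order
  `σ : Fin 21 → Fin 6 × Fin 6`, then for every REAL exponent vector `δ` with `StrictMono (pairSum δ ∘ σ)` no real symmetric pencil `∑ x^{δₗ} Sₗ` has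
  `20` positive det-zeros (`ncard ≤ 19`).  Proof = the tree's `posRootLawAt_iff_rpow` argument LOCALISED: persistent sign brackets
  (`Census.RealExp.exists_persistent_brackets`), a rational point `z/D` in the bracket ball AND in the open cone, the explicit integer support
  `eₗ = zₗ + Σ|z|` (same pair-sum order as `z`, hence as `δ`), and the integer row at `e`.
* `not_mem_closure_twentyLocus_of_cones` — **THE CENSUS RETIRES WALLS**: if a point `δ*` has a neighbourhood every point of which either has a
  pair-sum coincidence or lies in the real cone of one of finitely many orders carrying the integer row, then `δ*` is NOT in the closure of the
  twenty-locus.  At a GENERIC point of a facet between two chambers with landed rows the neighbourhood «wall ∪ the two cones» qualifies, so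
  obligations (M)/(D) hold there for free — the (M)-sieve (`Lines/wall_bubbling_M-sieve.md`) is needed only at facets with an uncertified side
  (located, this seat: 1 132 of the 4 640 mixed facets are both-landed at 1 242 rows).
* `facet_nhds` + `not_mem_closure_twentyLocus_of_adjacent_rows` — the generic-facet-point case made fully explicit: equality at one adjacent position
  `t` of `σ`, strictness at the others ⇒ a neighbourhood inside «wall ∪ cone(σ) ∪ cone(σ ∘ swap(t,t+1))»; with rows on both cones, no accumulation.
HONEST FRAMING.  Cell `pub-symmetroid`, seat val-sym-door-p2 g11 (re-pointed W1, R2664), `--supports stmt-ValiantsHypothesis-19979 --as helper`.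
Elementary (continuity, rational approximation, the tree's bracket lemma); no new definitions; (M), (D)-at-non-generic points, (W), (R) and `DoorA26` stay
OPEN; registers unchanged; nothing on `MatrixDescartes` (stmt-ValiantsHypothesis-18050) or `VP ≠ VNP`. [this work; folklore transfer]
-/

-- `Summit.ValiantsHypothesis.ValiantsHypothesis.…` repeats a component by the D-0017 layout
-- (single-conjunct summit), which the `dupNamespace` linter flags; the name is mandated.
set_option linter.dupNamespace false

namespace Summit.ValiantsHypothesis.ValiantsHypothesis.Theorems.LacunarySymmetroidMatrixDescartes.WallBubbling

open Finset Filter Topology Polynomial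
open scoped BigOperators Matrix
open Summit.ValiantsHypothesis.ValiantsHypothesis.Theorems.LacunarySymmetroidMatrixDescartes (PosRootLawOn)
open Summit.ValiantsHypothesis.ValiantsHypothesis.Theorems.LacunarySymmetroidMatrixDescartes.Census.RealExp
  (exists_persistent_brackets continuous_det_expPencil card_monotone_two_six exists_zero_of_mul_neg)
open Summit.ValiantsHypothesis.ValiantsHypothesis.Theorems.SymmetroidDescartes (eval_det_pencil)

/-! ## §1 An explicit integer support for a rational exponent vector -/

/-- **Explicit integer support.**  For `z : Fin K → ℤ`, `D ≥ 1`, `M = ∑ |zₗ|`, the natural numbers `eₗ = zₗ + M` satisfy: (i) along `x = e^{t/D}`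
the integer pencil `∑ X^{eₗ} Sₗ` vanishes at `x` iff the real-exponent pencil `∑ e^{(zₗ/D) t} Sₗ` vanishes at `t`; (ii) `(eₗ : ℝ) = zₗ + M`, so pair sums
of `e` are ordered exactly as those of `z`. [folklore] -/
theorem nat_support_explicit {m K : ℕ} (z : Fin K → ℤ) {D : ℕ} (hD : 0 < D) (S : Fin K → Matrix (Fin m) (Fin m) ℝ) :
    ∃ e : Fin K → ℕ, (∀ l, ((e l : ℕ) : ℝ) = (z l : ℝ) + ((∑ l', |z l'| : ℤ) : ℝ)) ∧ ∀ t : ℝ,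
      ((∑ l, (X : ℝ[X]) ^ e l • (S l).map C).det).eval (Real.exp (t / D)) = 0 ↔
        (∑ l, Real.exp (((z l : ℝ) / D) * t) • S l).det = 0 := by
  classical
  set M : ℤ := ∑ l, |z l| with hM
  have hnonneg : ∀ l, 0 ≤ z l + M := by
    intro l
    have h1 : |z l| ≤ M := by
      rw [hM]
      exact Finset.single_le_sum (f := fun l => |z l|) (fun l _ => abs_nonneg (z l)) (mem_univ l)
    have h2 : -|z l| ≤ z l := neg_abs_le (z l)
    linarith
  have hcast : ∀ l, ((((z l + M).toNat : ℕ)) : ℝ) = (z l : ℝ) + M := by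
    intro l
    have h := Int.toNat_of_nonneg (hnonneg l)
    exact_mod_cast h
  refine ⟨fun l => (z l + M).toNat, fun l => hcast l, fun t => ?_⟩
  have hD' : (D : ℝ) ≠ 0 := by exact_mod_cast hD.ne'
  have hpow : ∀ l, Real.exp (t / D) ^ (z l + M).toNat =
      Real.exp ((M : ℝ) * (t / D)) * Real.exp (((z l : ℝ) / D) * t) := by
    intro l
    rw [← Real.exp_nat_mul, ← Real.exp_add]
    congr 1
    rw [hcast l]
    field_simp
    ring
  rw [eval_det_pencil]
  have hsum : (∑ l, Real.exp (t / D) ^ (z l + M).toNat • S l) =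
      Real.exp ((M : ℝ) * (t / D)) • ∑ l, Real.exp (((z l : ℝ) / D) * t) • S l := by
    rw [Finset.smul_sum]
    refine Finset.sum_congr rfl fun l _ => ?_
    rw [hpow l, smul_smul]
  rw [hsum, Matrix.det_smul, Fintype.card_fin]
  constructor
  · intro h
    rcases mul_eq_zero.mp h with h | h
    · exact absurd h (pow_ne_zero _ (Real.exp_pos _).ne')
    · exact h
  · intro h
    rw [h, mul_zero]

/-! ## §2 The real cone of an order is open -/

/-- The real cone `{δ | StrictMono (pairSum δ ∘ σ)}` of a pair order `σ` is open. [folklore] -/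
theorem isOpen_realCone (σ : Fin 21 → Fin 6 × Fin 6) :
    IsOpen {δ : Fin 6 → ℝ | StrictMono ((fun p : Fin 6 × Fin 6 => δ p.1 + δ p.2) ∘ σ)} := by
  have hrw : {δ : Fin 6 → ℝ | StrictMono ((fun p : Fin 6 × Fin 6 => δ p.1 + δ p.2) ∘ σ)} =
      ⋂ i : Fin 20, {δ : Fin 6 → ℝ | δ (σ i.castSucc).1 + δ (σ i.castSucc).2 < δ (σ i.succ).1 + δ (σ i.succ).2} := by
    ext δ
    simp only [Set.mem_setOf_eq, Set.mem_iInter, Fin.strictMono_iff_lt_succ, Function.comp_apply]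
  rw [hrw]
  refine isOpen_iInter_of_finite fun i => ?_
  exact isOpen_lt (by fun_prop) (by fun_prop)

/-! ## §3 Cone transfer -/

/-- **CONE TRANSFER.**  If the door-A row `PosRootLawOn 2 6 19 d` holds for every integer support `d` whose pair sums increase strictly along
`σ`, then every REAL exponent vector `δ` in the open cone of `σ` carries no twenty: for all real symmetric letters the real-power pencil
`∑ x^{δₗ} Sₗ` has at most `19` positive det-zeros (as `Set.ncard`).
WHERE THE ROOTS SURVIVE THE PERTURBATION (crit-2 ask (β)): only the EXPONENTS are perturbed (`δ ↦ z/D`), the letters `S` stay fixed; the `20`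
zeros persist because they are SIGN CHANGES — the tree's `Census.RealExp.exists_persistent_brackets` (…CensusRealExponents): «if
`#{λ : Fin m → Fin K monotone} ≤ B + 2` and `t ↦ det ∑ e^{δₗ t} Sₗ` has `≥ B + 1` zeros (as `Set.ncard`), then there are `n ≥ B + 1` pairwise
disjoint increasing brackets `aᵢ < bᵢ` and a radius `r > 0` such that for EVERY `δ'` with `dist δ' δ < r` the determinant takes values of
opposite signs at `aᵢ`, `bᵢ`» — at the Descartes-sharp count every zero is simple (the kit's `expSum_deriv_ne_zero_of_sharp` inside that
lemma), so no even-multiplicity zero can be lost; this is the same route as the tree's global `posRootLawAt_iff_rpow`, localised to a cone. [this work] -/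
theorem realCone_row_of_natRow (σ : Fin 21 → Fin 6 × Fin 6)
    (hrow : ∀ d : Fin 6 → ℕ, StrictMono ((fun p : Fin 6 × Fin 6 => d p.1 + d p.2) ∘ σ) → PosRootLawOn 2 6 19 d)
    (δ : Fin 6 → ℝ) (hδ : StrictMono ((fun p : Fin 6 × Fin 6 => δ p.1 + δ p.2) ∘ σ))
    (S : Fin 6 → Matrix (Fin 2) (Fin 2) ℝ) (hS : ∀ l, (S l).IsSymm) :
    {x : ℝ | 0 < x ∧ (∑ l, (x ^ (δ l)) • S l).det = 0}.ncard ≤ 19 := by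
  classical
  by_contra hcon
  push Not at hcon
  rw [Census.RealExp.ncard_rpow_eq_ncard_exp δ S] at hcon
  obtain ⟨n, hnB, a, b, hab, hdisj, r, hr, hball⟩ :=
    exists_persistent_brackets (m := 2) (K := 6) (B := 19) (by rw [card_monotone_two_six]) δ S (by omega)
  -- the open cone gives a second radius
  obtain ⟨r', hr', hball'⟩ := Metric.isOpen_iff.mp (isOpen_realCone σ) δ hδ
  -- a point of `(1/D) ℤ⁶` within `min r r'`
  set ρ : ℝ := min r r' with hρ
  have hρpos : 0 < ρ := lt_min hr hr'
  set D : ℕ := ⌈1 / ρ⌉₊ + 1 with hD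
  have hD0 : 0 < D := Nat.succ_pos _
  have hDpos : (0 : ℝ) < D := by exact_mod_cast hD0
  have hDρ : 1 / (D : ℝ) < ρ := by
    have h1 : 1 / ρ < (D : ℝ) := by
      rw [hD]; push_cast
      exact (Nat.le_ceil (1 / ρ)).trans_lt (lt_add_one _)
    exact (one_div_lt hDpos hρpos).mpr h1
  set z : Fin 6 → ℤ := fun l => ⌊δ l * D⌋ with hz
  set δ' : Fin 6 → ℝ := fun l => (z l : ℝ) / D with hδ'
  have hdist : dist δ' δ < ρ := by
    rw [dist_pi_lt_iff hρpos]
    intro l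
    rw [Real.dist_eq]
    have h1 : (z l : ℝ) ≤ δ l * D := Int.floor_le _
    have h2 : δ l * D < (z l : ℝ) + 1 := Int.lt_floor_add_one _
    have heq : (z l : ℝ) / D - δ l = ((z l : ℝ) - δ l * D) / D := by field_simp
    have h3 : |(z l : ℝ) / D - δ l| ≤ 1 / D := by
      rw [heq, abs_le]
      constructor
      · rw [le_div_iff₀ hDpos]
        have : -(1 / (D : ℝ)) * D = -1 := by field_simp
        rw [this]; linarith
      · exact div_le_div_of_nonneg_right (by linarith) hDpos.le
    exact h3.trans_lt hDρ
  have hsign := hball δ' (lt_of_lt_of_le hdist (min_le_left _ _))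
  have hcone' : StrictMono ((fun p : Fin 6 × Fin 6 => δ' p.1 + δ' p.2) ∘ σ) :=
    hball' (Metric.mem_ball.mpr (lt_of_lt_of_le hdist (min_le_right _ _)))
  -- zeros of the perturbed pencil inside the brackets
  have hzeros : ∀ i, ∃ w ∈ Set.Ioo (a i) (b i),
      (∑ l, Real.exp (((z l : ℝ) / D) * w) • S l).det = 0 :=
    fun i => exists_zero_of_mul_neg (hab i)
      (continuous_det_expPencil (fun l => (z l : ℝ) / D) S).continuousOn (hsign i)
  choose w hwmem hw0 using hzeros
  have hwmono : StrictMono w := by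
    intro i j hij
    have h1 := (hwmem i).2
    have h2 := (hwmem j).1
    have h3 := hdisj i j hij
    linarith
  -- the integer support, in the same cone
  obtain ⟨e, hecast, he⟩ := nat_support_explicit z hD0 S
  have hecone : StrictMono ((fun p : Fin 6 × Fin 6 => e p.1 + e p.2) ∘ σ) := by
    rw [Fin.strictMono_iff_lt_succ]
    intro i
    have h := (Fin.strictMono_iff_lt_succ.mp hcone') i
    simp only [Function.comp_apply, hδ'] at h ⊢
    -- `(z a + z b)/D < (z c + z d)/D` ⇒ `z a + z b < z c + z d` ⇒ `e a + e b < e c + e d`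
    have h' : ((z (σ i.castSucc).1 : ℝ) + z (σ i.castSucc).2) < (z (σ i.succ).1 : ℝ) + z (σ i.succ).2 := by
      have := mul_lt_mul_of_pos_right h hDpos
      field_simp at this
      linarith
    have h'' : ((e (σ i.castSucc).1 : ℝ) + e (σ i.castSucc).2) < (e (σ i.succ).1 : ℝ) + e (σ i.succ).2 := by
      rw [hecast, hecast, hecast, hecast]; linarith
    exact_mod_cast h''
  set P : ℝ[X] := (∑ l, (X : ℝ[X]) ^ e l • (S l).map C).det with hP
  have hProot : ∀ i, P.eval (Real.exp (w i / D)) = 0 := fun i => by rw [hP, he]; exact hw0 i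
  have hn0 : 0 < n := by omega
  have hPne : P ≠ 0 := by
    intro h0
    have h1 : P.eval (Real.exp (a ⟨0, hn0⟩ / D)) = 0 := by rw [h0, eval_zero]
    rw [hP, he] at h1
    have h2 := hsign ⟨0, hn0⟩
    rw [h1, zero_mul] at h2
    exact lt_irrefl 0 h2
  set xs : Fin n → ℝ := fun i => Real.exp (w i / D) with hxs
  have hxsinj : Function.Injective xs := by
    intro i j hij
    have h1 := Real.exp_injective hij
    have h2 : w i = w j := by
      have h3 : w i / D * D = w j / D * D := by rw [h1]
      rwa [div_mul_cancel₀ _ hDpos.ne', div_mul_cancel₀ _ hDpos.ne'] at h3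
    exact hwmono.injective h2
  have hsub : univ.image xs ⊆ P.roots.toFinset.filter (fun x => 0 < x) := by
    intro x hx
    rw [Finset.mem_image] at hx
    obtain ⟨i, -, rfl⟩ := hx
    rw [Finset.mem_filter, Multiset.mem_toFinset, mem_roots hPne, IsRoot.def]
    exact ⟨hProot i, Real.exp_pos _⟩
  have hcard := Finset.card_le_card hsub
  rw [Finset.card_image_of_injective _ hxsinj, Finset.card_univ, Fintype.card_fin] at hcard
  have hle := hrow e hecone S hS
  rw [← hP] at hle
  omega

/-! ## §4 The census retires walls -/

/-- **THE CENSUS RETIRES WALLS.**  Let `δ*` have a neighbourhood `U` every point of which EITHER has a pair-sum coincidence between two distinct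
canonical pairs OR lies in the real cone of one of finitely many orders `σ ∈ L`, each carrying the integer door-A row.  Then `δ*` is not in the
closure of the twenty-locus.  (At a generic point of a facet between two chambers with landed rows, `U` = a small ball = wall ∪ the two cones.)
[this work] -/
theorem not_mem_closure_twentyLocus_of_cones (δ₀ : Fin 6 → ℝ) (L : List (Fin 21 → Fin 6 × Fin 6))
    (hrows : ∀ σ ∈ L, ∀ d : Fin 6 → ℕ, StrictMono ((fun p : Fin 6 × Fin 6 => d p.1 + d p.2) ∘ σ) → PosRootLawOn 2 6 19 d)
    (U : Set (Fin 6 → ℝ)) (hU : U ∈ 𝓝 δ₀)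
    (hcover : ∀ δ ∈ U,
      (∃ i j k l : Fin 6, i ≤ j ∧ k ≤ l ∧ (i, j) ≠ (k, l) ∧ δ i + δ j = δ k + δ l) ∨
      (∃ σ ∈ L, StrictMono ((fun p : Fin 6 × Fin 6 => δ p.1 + δ p.2) ∘ σ))) :
    δ₀ ∉ closure {δ : Fin 6 → ℝ | ∃ S : Fin 6 → Matrix (Fin 2) (Fin 2) ℝ, (∀ l, (S l).IsSymm) ∧
      20 ≤ {x : ℝ | 0 < x ∧ (∑ l, (x ^ (δ l)) • S l).det = 0}.ncard} := by
  intro hcl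
  rw [mem_closure_iff_nhds] at hcl
  obtain ⟨δ, hδU, S, hS, h20⟩ := hcl U hU
  rcases hcover δ hδU with ⟨i, j, k, l, hij, hkl, hne, hsum⟩ | ⟨σ, hσ, hmono⟩
  · -- a pair-sum coincidence leaves at most 20 monomials: no twenty (tree: `realRow_two_six_of_pairSum_eq`)
    have h := Census.RealExp.realRow_two_six_of_pairSum_eq δ hij hkl hne hsum S
    omega
  · have h := realCone_row_of_natRow σ (hrows σ hσ) δ hmono S hS
    omega

/-! ## §5 Generic facet points -/

/-- **Neighbourhood of a generic facet point.**  Let `a δ : Fin 21 → ℝ` be the pair sums of `δ` along an order `σ`, and let `δ₀` be a GENERIC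
point of the facet at position `t`: the `t`-th adjacent comparison is an equality and every other adjacent comparison is strict.  Then `δ₀` has
a neighbourhood every point of which either lies on the wall (the `t`-th comparison is an equality), or in the open cone of `σ`, or in the open
cone of the swapped order `σ ∘ swap(t, t+1)`. [this work] -/
theorem facet_nhds (σ : Fin 21 → Fin 6 × Fin 6) (t : Fin 20) (δ₀ : Fin 6 → ℝ)
    (h_eq : δ₀ (σ t.castSucc).1 + δ₀ (σ t.castSucc).2 = δ₀ (σ t.succ).1 + δ₀ (σ t.succ).2)
    (h_strict : ∀ i : Fin 20, i ≠ t → δ₀ (σ i.castSucc).1 + δ₀ (σ i.castSucc).2 < δ₀ (σ i.succ).1 + δ₀ (σ i.succ).2) :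
    ∃ U ∈ 𝓝 δ₀, ∀ δ ∈ U,
      δ (σ t.castSucc).1 + δ (σ t.castSucc).2 = δ (σ t.succ).1 + δ (σ t.succ).2 ∨
      StrictMono ((fun p : Fin 6 × Fin 6 => δ p.1 + δ p.2) ∘ σ) ∨
      StrictMono ((fun p : Fin 6 × Fin 6 => δ p.1 + δ p.2) ∘ σ ∘ Equiv.swap t.castSucc t.succ) := by
  -- pair-sum functional at an index
  let a : (Fin 6 → ℝ) → Fin 21 → ℝ := fun δ i => δ (σ i).1 + δ (σ i).2
  have ha_cont : ∀ i, Continuous fun δ : Fin 6 → ℝ => a δ i := fun i => by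
    show Continuous fun δ : Fin 6 → ℝ => δ (σ i).1 + δ (σ i).2
    fun_prop
  -- the neighbourhood: all comparisons that are strict at δ₀ among {(i, i+1), i ≠ t} ∪ {(t-1, t+1), (t, t+2)} stay strict
  let good : Fin 21 → Fin 21 → Prop := fun i j => a δ₀ i < a δ₀ j
  let U : Set (Fin 6 → ℝ) := ⋂ i : Fin 21, ⋂ j : Fin 21, {δ | good i j → a δ i < a δ j}
  have hUopen : IsOpen U := by
    refine isOpen_iInter_of_finite fun i => isOpen_iInter_of_finite fun j => ?_
    by_cases hg : good i j
    · have : {δ : Fin 6 → ℝ | good i j → a δ i < a δ j} = {δ | a δ i < a δ j} := by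
        ext δ; simp [hg]
      rw [this]; exact isOpen_lt (ha_cont i) (ha_cont j)
    · have : {δ : Fin 6 → ℝ | good i j → a δ i < a δ j} = Set.univ := by
        ext δ; simp [hg]
      rw [this]; exact isOpen_univ
  have hU0 : δ₀ ∈ U := by
    simp only [U, Set.mem_iInter, Set.mem_setOf_eq]
    intro i j hg; exact hg
  refine ⟨U, hUopen.mem_nhds hU0, fun δ hδ => ?_⟩
  simp only [U, Set.mem_iInter, Set.mem_setOf_eq] at hδ
  -- transport of strictness: every comparison strict at δ₀ is strict at δ
  have hlt : ∀ i j : Fin 21, a δ₀ i < a δ₀ j → a δ i < a δ j := fun i j h => hδ i j h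
  -- monotonicity of a δ₀ away from t gives the auxiliary comparisons at δ₀
  have hmono₀ : ∀ i j : Fin 21, i < j → (i, j) ≠ (t.castSucc, t.succ) → a δ₀ i < a δ₀ j := by
    -- a δ₀ is monotone (weakly) with the only non-strict step at t
    have hstep : ∀ i : Fin 20, a δ₀ i.castSucc ≤ a δ₀ i.succ := by
      intro i
      by_cases hi : i = t
      · subst hi; exact le_of_eq h_eq
      · exact le_of_lt (h_strict i hi)
    have hmono : Monotone (a δ₀) := Fin.monotone_iff_le_succ.mpr hstep
    intro i j hij hne
    -- find a strict step between i and j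
    rcases lt_or_ge (i : ℕ) t with hit | hit
    · -- the step (i, i+1) is strict (i ≠ t as i < t)
      have hi20 : (i : ℕ) < 20 := by omega
      set i' : Fin 20 := ⟨i, hi20⟩ with hi'
      have hne' : i' ≠ t := by intro h; rw [Fin.ext_iff] at h; simp [hi'] at h; omega
      have h1 := h_strict i' hne'
      have hcs : i'.castSucc = i := Fin.ext (by simp [hi'])
      have hsu : i'.succ ≤ j := by rw [Fin.le_iff_val_le_val]; simp [hi']; omega
      calc a δ₀ i = a δ₀ i'.castSucc := by rw [hcs]
        _ < a δ₀ i'.succ := h1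
        _ ≤ a δ₀ j := hmono hsu
    · -- i ≥ t as values; the step (j-1, j) is strict unless j = t+1 and i = t
      have hj20 : (j : ℕ) - 1 < 20 := by omega
      set j' : Fin 20 := ⟨j - 1, hj20⟩ with hj'
      have hjs : j'.succ = j := Fin.ext (by simp [hj']; omega)
      by_cases hjt : j' = t
      · -- then j = t+1 and t ≤ i < j forces i = t: excluded
        exfalso; apply hne
        have hjv : (j : ℕ) = t + 1 := by rw [Fin.ext_iff] at hjt; simp [hj'] at hjt; omega
        ext <;> simp <;> omega
      · have h1 := h_strict j' hjt
        have hcs : i ≤ j'.castSucc := by rw [Fin.le_iff_val_le_val]; simp [hj']; omega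
        calc a δ₀ i ≤ a δ₀ j'.castSucc := hmono hcs
          _ < a δ₀ j'.succ := h1
          _ = a δ₀ j := by rw [hjs]
  rcases lt_trichotomy (a δ t.castSucc) (a δ t.succ) with hlt_t | heq_t | hgt_t
  · -- in the cone of σ
    refine Or.inr (Or.inl ?_)
    rw [Fin.strictMono_iff_lt_succ]
    intro i
    by_cases hi : i = t
    · subst hi; exact hlt_t
    · exact hlt _ _ (h_strict i hi)
  · exact Or.inl heq_t
  · -- in the cone of the swapped order
    refine Or.inr (Or.inr ?_)
    rw [Fin.strictMono_iff_lt_succ]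
    intro i
    show a δ (Equiv.swap t.castSucc t.succ i.castSucc) < a δ (Equiv.swap t.castSucc t.succ i.succ)
    by_cases hi : i = t
    · subst hi
      rw [Equiv.swap_apply_left, Equiv.swap_apply_right]; exact hgt_t
    · by_cases hprev : i.succ = t.castSucc
      · -- i = t - 1: compare a(i) with a(t+1)
        have hfix : Equiv.swap t.castSucc t.succ i.castSucc = i.castSucc := by
          apply Equiv.swap_apply_of_ne_of_ne
          · intro h; rw [Fin.ext_iff] at h hprev; simp at h hprev; omega
          · intro h; rw [Fin.ext_iff] at h hprev; simp at h hprev; omega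
        rw [hfix, hprev, Equiv.swap_apply_left]
        apply hlt
        apply hmono₀
        · rw [Fin.lt_def]; rw [Fin.ext_iff] at hprev; simp at hprev ⊢; omega
        · intro h; rw [Prod.ext_iff] at h; simp only at h
          have := h.1; rw [Fin.ext_iff] at this hprev; simp at this hprev; omega
      · by_cases hnext : i.castSucc = t.succ
        · -- i = t + 1: compare a(t) with a(i+1)
          have hfix : Equiv.swap t.castSucc t.succ i.succ = i.succ := by
            apply Equiv.swap_apply_of_ne_of_ne
            · intro h; rw [Fin.ext_iff] at h hnext; simp at h hnext; omega
            · intro h; rw [Fin.ext_iff] at h hnext; simp at h hnext; omega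
          rw [hfix, hnext, Equiv.swap_apply_right]
          apply hlt
          apply hmono₀
          · rw [Fin.lt_def]; rw [Fin.ext_iff] at hnext; simp at hnext ⊢; omega
          · intro h; rw [Prod.ext_iff] at h; simp only at h
            have := h.2; rw [Fin.ext_iff] at this hnext; simp at this hnext; omega
        · -- far from t: the swap fixes both
          have hfix1 : Equiv.swap t.castSucc t.succ i.castSucc = i.castSucc := by
            apply Equiv.swap_apply_of_ne_of_ne
            · intro h; apply hi; rw [Fin.ext_iff] at h ⊢; simpa using h
            · exact hnext
          have hfix2 : Equiv.swap t.castSucc t.succ i.succ = i.succ := by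
            apply Equiv.swap_apply_of_ne_of_ne
            · exact hprev
            · intro h; apply hi; rw [Fin.ext_iff] at h ⊢; simpa using h
          rw [hfix1, hfix2]
          exact hlt _ _ (h_strict i hi)


/-- **(M)/(D) FOR FREE AT A GENERIC FACET POINT BETWEEN TWO LANDED CHAMBERS.**  Let `σ` be a pair order with canonical pairs (`fst ≤ snd`), `t` a
position with `σ t ≠ σ (t+1)`, and suppose the integer door-A row holds on the cone of `σ` AND on the cone of the swapped order `σ ∘ swap(t,t+1)`
(the chamber across the facet).  Then no GENERIC point `δ₀` of the facet (equality at `t`, all other adjacent comparisons strict) lies in the closure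
of the twenty-locus — twenties do not accumulate there, whatever the type (mixed / disjoint) of the wall. [this work] -/
theorem not_mem_closure_twentyLocus_of_adjacent_rows (σ : Fin 21 → Fin 6 × Fin 6) (t : Fin 20)
    (hcan : ∀ i, (σ i).1 ≤ (σ i).2) (hne : σ t.castSucc ≠ σ t.succ)
    (hrow : ∀ d : Fin 6 → ℕ, StrictMono ((fun p : Fin 6 × Fin 6 => d p.1 + d p.2) ∘ σ) → PosRootLawOn 2 6 19 d)
    (hrow' : ∀ d : Fin 6 → ℕ, StrictMono ((fun p : Fin 6 × Fin 6 => d p.1 + d p.2) ∘ σ ∘ Equiv.swap t.castSucc t.succ) →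
      PosRootLawOn 2 6 19 d)
    (δ₀ : Fin 6 → ℝ)
    (h_eq : δ₀ (σ t.castSucc).1 + δ₀ (σ t.castSucc).2 = δ₀ (σ t.succ).1 + δ₀ (σ t.succ).2)
    (h_strict : ∀ i : Fin 20, i ≠ t → δ₀ (σ i.castSucc).1 + δ₀ (σ i.castSucc).2 < δ₀ (σ i.succ).1 + δ₀ (σ i.succ).2) :
    δ₀ ∉ closure {δ : Fin 6 → ℝ | ∃ S : Fin 6 → Matrix (Fin 2) (Fin 2) ℝ, (∀ l, (S l).IsSymm) ∧
      20 ≤ {x : ℝ | 0 < x ∧ (∑ l, (x ^ (δ l)) • S l).det = 0}.ncard} := by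
  obtain ⟨U, hU, hcov⟩ := facet_nhds σ t δ₀ h_eq h_strict
  refine not_mem_closure_twentyLocus_of_cones δ₀ [σ, σ ∘ Equiv.swap t.castSucc t.succ] ?_ U hU ?_
  · intro τ hτ d hd
    simp only [List.mem_cons, List.mem_nil_iff, or_false] at hτ
    rcases hτ with rfl | rfl
    · exact hrow d hd
    · exact hrow' d hd
  · intro δ hδ
    rcases hcov δ hδ with h | h | h
    · left
      exact ⟨(σ t.castSucc).1, (σ t.castSucc).2, (σ t.succ).1, (σ t.succ).2, hcan _, hcan _,
        fun hp => hne (Prod.ext (Prod.mk.inj hp).1 (Prod.mk.inj hp).2), h⟩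
    · right; exact ⟨σ, by simp, h⟩
    · right; exact ⟨σ ∘ Equiv.swap t.castSucc t.succ, by simp, h⟩

end Summit.ValiantsHypothesis.ValiantsHypothesis.Theorems.LacunarySymmetroidMatrixDescartes.WallBubbling
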